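import Literature.MathematicalPhysics.KineticTheory.MetropolisOddStatistic
import Literature.Analysis.FluidPDE.HardSphereCollisionRecord
import HarnessLib

/-!
# Sketch — first lemmas of the crux idea `snapshot-scale-bridge` (crux stmt-AtomisticToContinuum-17722, strategist s1)

Two checkable statements that start the reduction of the two-scale bridge S6 (`stub_scaleTransfer`, child `OddScaleBridge`)
to a FIXED-TIME ("snapshot") two-scale consistency of the kernel density estimate on the incoming thin shell:

* `abs_minWeight_sub_minWeight_le` — the Metropolis weight is 1-Lipschitz and bounded: `|min(1,e^{-x}) − min(1,e^{-y})| ≤ min 1 |x − y|`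
  (PROVED).  Hence the mark difference between reading scales `r` and `r'` is dominated, collision by collision, by
  `|χ| (C_Ψ |g(σ³ρ_r) − g(σ³ρ_{r'})| + C_g C_Ψ min(1, |F_r − F_{r'}|))` — an EVEN, non-negative mark with no sign structure.
* `abs_metroOddSum_sub_le_collisionPairSum` — pathwise on the good set, the difference of the two statistics over any window is
  bounded by the collision pair sum of the absolute mark differences (PROVED, triangle inequality over the record); this is the
  entry point of the landed tube pull-back (`collisionSum_sub_integral_tubeStat_le`), which turns the right-hand side into a time
  integral of fixed-time thin-shell functionals.
-/

noncomputable section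

open scoped BigOperators Classical ENNReal
open Set MeasureTheory
open Literature.Analysis.FluidPDE Literature.MathematicalPhysics.KineticTheory

namespace Summit.AtomisticToContinuum.HydrodynamicLimit.Cruxes.OddContactSymmetry.SnapshotScaleBridge

/-- `min 1 (exp (-x)) = exp (-(max x 0))`. [folklore] -/
theorem minWeight_eq_exp_neg_max (x : ℝ) : min 1 (Real.exp (-x)) = Real.exp (-(max x 0)) := by
  rcases le_total x 0 with hx | hx
  · rw [max_eq_right hx, neg_zero, Real.exp_zero, min_eq_left]
    calc (1 : ℝ) = Real.exp 0 := Real.exp_zero.symm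
      _ ≤ Real.exp (-x) := Real.exp_le_exp.2 (by linarith)
  · rw [max_eq_left hx, min_eq_right]
    calc Real.exp (-x) ≤ Real.exp 0 := Real.exp_le_exp.2 (by linarith)
      _ = 1 := Real.exp_zero

/-- `exp` is 1-Lipschitz on `(-∞, 0]`: for `a, b ≤ 0`, `|e^a − e^b| ≤ |a − b|`. [folklore] -/
theorem abs_exp_sub_exp_le_of_nonpos {a b : ℝ} (ha : a ≤ 0) (hb : b ≤ 0) :
    |Real.exp a - Real.exp b| ≤ |a - b| := by
  -- reduce to `b ≤ a`
  wlog hab : b ≤ a generalizing a b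
  · have h := this hb ha (not_le.mp hab).le
    rwa [abs_sub_comm, abs_sub_comm a b]
  have h1 : Real.exp b ≤ Real.exp a := Real.exp_le_exp.2 hab
  rw [abs_of_nonneg (sub_nonneg.2 h1), abs_of_nonneg (sub_nonneg.2 hab)]
  -- `e^a − e^b = e^a (1 − e^{b−a}) ≤ e^a (a − b) ≤ a − b`
  have h2 : 1 - Real.exp (b - a) ≤ a - b := by
    have := Real.add_one_le_exp (b - a)
    linarith
  have hea : Real.exp a ≤ 1 := by
    calc Real.exp a ≤ Real.exp 0 := Real.exp_le_exp.2 ha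
      _ = 1 := Real.exp_zero
  have hea0 : 0 < Real.exp a := Real.exp_pos a
  calc Real.exp a - Real.exp b = Real.exp a * (1 - Real.exp (b - a)) := by
        rw [mul_sub, mul_one, ← Real.exp_add]; congr 2; ring
    _ ≤ Real.exp a * (a - b) := mul_le_mul_of_nonneg_left h2 hea0.le
    _ ≤ 1 * (a - b) := mul_le_mul_of_nonneg_right hea (sub_nonneg.2 hab)
    _ = a - b := one_mul _

/-- **The Metropolis weight is 1-Lipschitz and bounded**: `|min(1,e^{-x}) − min(1,e^{-y})| ≤ min 1 |x − y|`.  This is what makes the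
two-scale bridge an UNSIGNED statement about `|F_r − F_{r'}| ∧ 1` on the collision measure. [folklore] -/
theorem abs_minWeight_sub_minWeight_le (x y : ℝ) :
    |min 1 (Real.exp (-x)) - min 1 (Real.exp (-y))| ≤ min 1 |x - y| := by
  rw [minWeight_eq_exp_neg_max, minWeight_eq_exp_neg_max]
  refine le_min ?_ ?_
  · -- both values lie in `(0, 1]`
    have h0x : 0 < Real.exp (-(max x 0)) := Real.exp_pos _
    have h0y : 0 < Real.exp (-(max y 0)) := Real.exp_pos _
    have h1x : Real.exp (-(max x 0)) ≤ 1 := by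
      calc Real.exp (-(max x 0)) ≤ Real.exp 0 := Real.exp_le_exp.2 (by simp)
        _ = 1 := Real.exp_zero
    have h1y : Real.exp (-(max y 0)) ≤ 1 := by
      calc Real.exp (-(max y 0)) ≤ Real.exp 0 := Real.exp_le_exp.2 (by simp)
        _ = 1 := Real.exp_zero
    rw [abs_le]; constructor <;> linarith
  · calc |Real.exp (-(max x 0)) - Real.exp (-(max y 0))| ≤ |(-(max x 0)) - (-(max y 0))| :=
          abs_exp_sub_exp_le_of_nonpos (by simp) (by simp)
      _ = |max y 0 - max x 0| := by congr 1; ring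
      _ ≤ |y - x| := abs_max_sub_max_le_abs _ _ _
      _ = |x - y| := abs_sub_comm _ _

/-- **Pathwise reduction of the bridge to an unsigned collision pair sum.**  On a good initial datum, for any window `S`, the
difference of the Metropolis-odd sums read at two scales `r, r'` is bounded by the collision pair sum of the absolute mark differences
(to which the landed tube pull-back applies). [folklore] -/
theorem abs_metroOddSum_sub_le_collisionPairSum {σ : ℝ} {N : ℕ}
    (Φ : HardSphereFlow (Torus.geometry (Fin 3)) (hsDiameter σ N) (N + 1)) (S : Set ℝ)
    (χ : ℝ × UnitAddTorus (Fin 3) → ℝ) (g : ℝ → ℝ)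
    (Ψ : EuclideanSpace ℝ (Fin 3) × EuclideanSpace ℝ (Fin 3) × EuclideanSpace ℝ (Fin 3) → ℝ) (r r' ϑ : ℝ)
    {z : Config (N + 1) (Fin 3) T3} (hz : z ∈ Φ.good)
    (hfin : (collisionTimes (Torus.geometry (Fin 3)) (hsDiameter σ N) (fun t => Φ.flow t z) ∩ S).Finite) :
    |metroOddSum σ N Φ S χ g Ψ r ϑ z - metroOddSum σ N Φ S χ g Ψ r' ϑ z| ≤
      Φ.collisionPairSum S (fun t z' i j => |metroOddMark σ N χ g Ψ r ϑ t z' i j - metroOddMark σ N χ g Ψ r' ϑ t z' i j|) z := by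
  rw [metroOddSum_eq_collisionPairSum_of_mem_good _ _ hz, metroOddSum_eq_collisionPairSum_of_mem_good _ _ hz]
  unfold HardSphereFlow.collisionPairSum
  rw [collisionPairSum_eq_finset_sum hfin, collisionPairSum_eq_finset_sum hfin,
    collisionPairSum_eq_finset_sum hfin, ← Finset.sum_sub_distrib]
  refine (Finset.abs_sum_le_sum_abs _ _).trans (Finset.sum_le_sum fun t _ => ?_)
  rw [← Finset.sum_sub_distrib]
  exact Finset.abs_sum_le_sum_abs _ _

end Summit.AtomisticToContinuum.HydrodynamicLimit.Cruxes.OddContactSymmetry.SnapshotScaleBridge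

end
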